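import Summits.QuantumFields.QCD.Theorems.GaussianLinkFramesFrameFMClosureTwoStarOfPaddedAux8
import Summits.QuantumFields.QCD.Theorems.GaussianLinkFramesPadTheFibreDefs
import Summits.QuantumFields.QCD.Theorems.GaussianLinkFramesFrameFMClosurePlacementCollarAux6

/-!
# Crux `GaussianLinkFrames.FrameFMClosure` (stmt-QuantumFields-17375), line `pad-the-fibre` — registered stub
`stub_placementCollar`: the (collar) placements from padded cofactor domination on large tori

Stub 2b of the line (RESHAPE gen 2): VERBATIM the hypothesis `hC` of the landed region-generic two-star re-run
`PadTheFibreTwoStar.twoStarBounds_of_placements` (helper 8), discharged from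
`PadTheFibre.PaddedCofactorDominationLarge`.  For the thick collar `W = ebox x ℓ ⊂ Λ = ebox x (3ℓ+2)` of clause
(T1) (`1 ≤ ℓ`, `3ℓ+4 ≤ S`, so `S ≥ 7 ≥ 4`) and `u', v ∈ Λ ∖ W`, the balanced canonical placement
`PadTheFibreCollar.collar_placement` (helpers `…PlacementCollarAux1–6`) gives pad centres holding `u', v` in their
cores, canonical pad regions `Q₁, Q₂` with frozen boundary layers inside `W` / outside `Λ`, `≤ 2064` links, no link
inside `W`, none inside `Λᶜ`, and a balanced touched region; `PaddedCofactorDominationLarge` at the side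
`A = univ` then dominates the `(u', v)` adjugate block in the `∀ W ∃ W'` form, and
`PadTheFibreTwoStar.dom_sup_of_forall_exists` gives the `sup` form (`n₂ = 2064`, `C₂ = C₀`).

The recipe (one pad per point; pad centre `b` with `b₀ ≡ ℓ (mod 2)`; unfrozen block + two defects per excluded
frozen layer; the aligned `0`-flip on the blocks and the complementary `0`-flip on the defects as ONE global
nearest-neighbour pairing) needs no case analysis on the relative position of `u'` and `v` and covers the corners
and edges of `Λ`; no collar configuration is unbalanceable.

References: Aizenman–Schenker–Friedrich–Hundertmark, CMP 224 (2001) 219, Lemma 5 [AizenmanEtAl2001] (clause (T1));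
placement recipe of the line card `pad-the-fibre` (triage r1-1 sharpen 1).
-/

noncomputable section

namespace Summit.QuantumFields.QCD.Cruxes.FrameFMClosure.PadTheFibre

open scoped BigOperators
open MeasureTheory Filter
open Literature.MathematicalPhysics.QuantumFieldTheory Literature.MathematicalPhysics.QuantumLattice
  Literature.Probability.LatticeModels
open Summit.QuantumFields.QCD.Theorems.VonMisesCircles Summit.QuantumFields.QCD.Theorems.PadTheFibre
  Summit.QuantumFields.QCD.Theorems.PadTheFibreTwoStar Summit.QuantumFields.QCD.Theorems.PadTheFibreCollar

/-- **stub 2b — the (collar) placements from padded domination on large tori** (registered stub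
`stub_placementCollar` of crux stmt-QuantumFields-17375, line `pad-the-fibre`): for the thick-collar geometry of
clause (T1) (`W = ebox x ℓ ⊂ Λ = ebox x (3ℓ+2)`, `3ℓ+4 ≤ S`, `u', v ∈ Λ ∖ W`) a refit region of `≤ n₂` links with NO
link inside `W` and none inside `Λᶜ` dominating the `(u',v)` block of `adj D` — VERBATIM the hypothesis `hC` of
`twoStarBounds_of_placements`; placement `PadTheFibreCollar.collar_placement`. [cite: AizenmanEtAl2001, Lemma 5] -/
theorem stub_placementCollar : PaddedCofactorDominationLarge →
      ∃ (n₂ : ℕ) (C₂ : ℝ), 0 < C₂ ∧ ∀ (m₀ : ℝ), -9 ≤ m₀ → m₀ ≤ 1 → ∀ (S : ℕ) (x : TorusSite 4 (2 * S + 1)) (ℓ : ℕ),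
      1 ≤ ℓ → 3 * ℓ + 4 ≤ S → ∀ (u' v : TorusSite 4 (2 * S + 1)), u' ∈ ebox S x (3 * ℓ + 2) → u' ∉ ebox S x ℓ → v ∈
      ebox S x (3 * ℓ + 2) → v ∉ ebox S x ℓ → ∃ R : Finset (Edge 4 (2 * S + 1)), R.card ≤ n₂ ∧ (∀ e ∈ R, ¬(e.1 ∈
      ebox S x ℓ ∧ Site.shift e.1 e.2 ∈ ebox S x ℓ)) ∧ (∀ e ∈ R, ¬(e.1 ∈ (ebox S x (3 * ℓ + 2))ᶜ ∧ Site.shift e.1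
      e.2 ∈ (ebox S x (3 * ℓ + 2))ᶜ)) ∧ ∀ U W : GaugeConfig 4 (2 * S + 1) (Matrix.specialUnitaryGroup (Fin 3) ℂ),
      blockNorm ((sideMatrix Finset.univ (wilsonD (fun e => if e ∈ R then W e else U e) m₀)).adjugate) u' v ≤ C₂ * ⨆
      W' : GaugeConfig 4 (2 * S + 1) (Matrix.specialUnitaryGroup (Fin 3) ℂ), ‖(sideMatrix Finset.univ (wilsonD (fun
      e => if e ∈ R then W' e else U e) m₀)).det‖ := by
  rintro ⟨C₀, hC₀, hP⟩
  refine ⟨2064, C₀, hC₀, fun m₀ hm₁ hm₂ S x ℓ hℓ hℓS u' v hu'Λ hu'W hvΛ hvW => ?_⟩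
  have hS4 : 4 ≤ S := by omega
  -- chart coordinates of the two points
  obtain ⟨au, hau, rfl⟩ := (mem_ebox_iff x u' (3 * ℓ + 2)).1 hu'Λ
  obtain ⟨av, hav, rfl⟩ := (mem_ebox_iff x v (3 * ℓ + 2)).1 hvΛ
  have hau' : ∀ i, -(3 * (ℓ : ℤ) + 3) ≤ au i ∧ au i ≤ 3 * ℓ + 2 := fun i => by
    have := hau i; push_cast at this; omega
  have hav' : ∀ i, -(3 * (ℓ : ℤ) + 3) ≤ av i ∧ av i ≤ 3 * ℓ + 2 := fun i => by
    have := hav i; push_cast at this; omega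
  have hauW : ¬ ∀ i, -(ℓ : ℤ) - 1 ≤ au i ∧ au i ≤ ℓ := fun h => hu'W ((mem_ebox_chart x au ℓ).1 h)
  have havW : ¬ ∀ i, -(ℓ : ℤ) - 1 ≤ av i ∧ av i ≤ ℓ := fun h => hvW ((mem_ebox_chart x av ℓ).1 h)
  -- the balanced canonical placement and padded domination at the side `univ`
  obtain ⟨x', y', Q₁, Q₂, hcu, hcv, hQ₁, hQ₂, hbal, hcard, hW, hΛ⟩ :=
    collar_placement x ℓ hℓ hℓS au av hau' hauW hav' havW
  refine ⟨starLinks S (x + Torus.proj (2 * S + 1) au) ∪ starLinks S (x + Torus.proj (2 * S + 1) av) ∪ Q₁ ∪ Q₂,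
    hcard, hW, hΛ, fun U W => ?_⟩
  exact dom_sup_of_forall_exists Finset.univ m₀ C₀ hC₀.le _ _ _ U
    (fun W => hP m₀ hm₁ hm₂ S hS4 U Finset.univ (Or.inl rfl) _ _ (Finset.mem_univ _) (Finset.mem_univ _)
      x' y' hcu hcv Q₁ Q₂ hQ₁ hQ₂ hbal W) W

end Summit.QuantumFields.QCD.Cruxes.FrameFMClosure.PadTheFibre

end
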